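import Summits.Ventures.PercRepro.C025ProfileGirthHall
import Summits.Ventures.PercRepro.C025ProfileGirthRowSuccPre

/-!
# THE ROWS `(q, u)` AT GIRTH `≥ u − 1` — PART A: THE DOUBLE COUNT (night-3 g19)

g18 closed the rows `(q, u)` of `(Π)` and their Hall form at girth `≥ u` (every set of `≤ u − 1` points independent,
`q ≤ u − 2`) by the injection `C ↦ C ∪ {y_C}` of the `u`-circuits into the `(u+1)`-sets of rank `u`.  One step further
down, at girth `≥ u − 1` (every set of `≤ u − 2` points independent; `u = v + 2` below), a `u`-subset has rank `u`
(independent), `u − 1` (nullity one) or `u − 2` (nullity two), and no injection into the `(u+1)`-sets alone exists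
(own max-flow on the 9-element catalogue: 384 failures at `u = 3`).  A DOUBLE COUNT does it, at `ρ(E) ≥ u + 1`:
* a `u`-set of rank `u − 1` lies in `≥ 2` sets `S ∪ {y}` of rank `u` (`y ∉ cl S`; two points outside the closure since
  `ρ(E) ≥ ρ(S) + 2`), and a `(u+1)`-set of rank `u` contains `≤ 2` such subsets (`card_filter_rkN_le_two`: three of
  them, `T ∖ y₁, T ∖ y₂, T ∖ y₃`, force `ρ(T ∖ {y_i, y_j}) = v` by submodularity and then `v + (v+1) ≤ v + v` on
  `T ∖ {y₁,y₂}`, `T ∖ {y₁,y₃}` — against the girth on the `v`-set `T ∖ {y₁,y₂,y₃}`);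
* a `u`-set of rank `u − 2` lies in `≥ 1` set `S ∪ {y, y'}` of rank `u`, and a `(u+2)`-set of rank `u` contains `≤ 1`
  such subset (`card_filter_rkN_le_one`: two of them meet in `≥ v` points, so their union has rank `≤ v` by
  submodularity, but it has `≥ v + 3` points inside a `(v+4)`-set of rank `v + 2`).
`card_le_card_of_girth_pred_family` is the family form (as g18's `card_le_card_of_girth_family`): any family of
`(v+2)`-subsets of the ground set injects — by count, `Finset.card_mul_le_card_mul` — into any family containing its
independent members and the required extensions.  No `def`, no `instance`, no notation.  Axioms: standard.
-/

open scoped Matroid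

namespace PercRepro

open Set Finset ThmH Staged

namespace GirthRows

variable {α : Type} [DecidableEq α] {M : Matroid α} [M.Finite]

/-- `ρ(T) ≤ ρ(X) + #(T ∖ X)` for `X ⊆ T`. -/
theorem rkN_le_rkN_add_card_sdiff {X T : Finset α} (hXT : X ⊆ T) :
    rkN M T ≤ rkN M X + (T \ X).card := by
  have h1 : M.eRk (T : Set α) ≤ M.eRk (X : Set α) + ((T \ X : Finset α) : Set α).encard := by
    have hT : (T : Set α) = (X : Set α) ∪ ((T \ X : Finset α) : Set α) := by
      rw [Finset.coe_sdiff, Set.union_sdiff_cancel (Finset.coe_subset.2 hXT)]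
    rw [hT]
    exact M.eRk_union_le_eRk_add_encard _ _
  rw [← Staged.coe_rkN, ← Staged.coe_rkN, Set.encard_coe_eq_coe_finsetCard] at h1
  exact_mod_cast h1

omit [DecidableEq α] in
/-- At girth `≥ v + 1`, a subset of the ground set with at least `v` points has rank at least `v`. -/
theorem le_rkN_of_girth {v : ℕ} (hg : ∀ T ⊆ M.E, T.encard ≤ v → M.Indep T) {S : Finset α}
    (hSg : S ⊆ gr M) (hv : v ≤ S.card) : v ≤ rkN M S := by
  obtain ⟨R, hRS, hRc⟩ := Finset.exists_subset_card_eq hv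
  have hRg : ((R : Finset α) : Set α) ⊆ M.E := by
    rw [← coe_gr]; exact_mod_cast hRS.trans hSg
  have hRi : M.Indep ((R : Finset α) : Set α) :=
    hg _ hRg (by rw [Set.encard_coe_eq_coe_finsetCard, hRc])
  have h2 : rkN M R = v := by
    rw [Staged.rkN_eq_iff, hRi.eRk_eq_encard, Set.encard_coe_eq_coe_finsetCard, hRc]
  rw [← h2]
  exact Staged.rkN_mono hRS

omit [DecidableEq α] in
/-- At girth `≥ v + 1`, a `v`-subset of the ground set has rank `v`. -/
theorem rkN_eq_of_card_eq_of_girth {v : ℕ} (hg : ∀ T ⊆ M.E, T.encard ≤ v → M.Indep T) {S : Finset α}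
    (hSg : S ⊆ gr M) (hSc : S.card = v) : rkN M S = v :=
  le_antisymm (hSc ▸ Staged.rkN_le_card S) (le_rkN_of_girth hg hSg hSc.ge)

/-- Two distinct erasures of `T`: the intersection. -/
theorem erase_inter_erase_eq {T : Finset α} {a b : α} : (T.erase a) ∩ (T.erase b) = (T.erase a).erase b := by
  ext x
  simp only [Finset.mem_inter, Finset.mem_erase]
  tauto

/-- Two distinct erasures of `T`: the union. -/
theorem erase_union_erase_eq {T : Finset α} {a b : α} (hab : a ≠ b) :
    (T.erase a) ∪ (T.erase b) = T := by
  ext x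
  simp only [Finset.mem_union, Finset.mem_erase]
  constructor
  · rintro (⟨_, h⟩ | ⟨_, h⟩) <;> exact h
  · intro hx
    by_cases hxa : x = a
    · right; exact ⟨hxa ▸ hab, hx⟩
    · left; exact ⟨hxa, hx⟩

/-- **Three coloops contradict the girth.** A `(v+3)`-subset `T` of the ground set of rank `v + 2`, at girth `≥ v + 1`,
has at most two points `y` with `ρ(T ∖ y) = v + 1`. -/
theorem card_filter_erase_le_two {v : ℕ} (hg : ∀ T ⊆ M.E, T.encard ≤ v → M.Indep T) {T : Finset α}
    (hTg : T ⊆ gr M) (hTc : T.card = v + 3) (hTr : rkN M T = v + 2) :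
    (T.filter (fun y => rkN M (T.erase y) = v + 1)).card ≤ 2 := by
  by_contra hcon
  have h3 : 2 < (T.filter (fun y => rkN M (T.erase y) = v + 1)).card := by omega
  obtain ⟨y₁, h₁, y₂, h₂, y₃, h₃, h12, h13, h23⟩ := Finset.two_lt_card.1 h3
  rw [Finset.mem_filter] at h₁ h₂ h₃
  -- a double erasure has rank exactly `v`
  have hpair : ∀ a b : α, a ≠ b → a ∈ T → b ∈ T → rkN M (T.erase a) = v + 1 → rkN M (T.erase b) = v + 1 →
      rkN M ((T.erase a).erase b) = v := by
    intro a b hab ha hb hra hrb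
    have hsub := ThinTriangle.rkN_inter_add_union_le (M := M) (T.erase a) (T.erase b)
    rw [erase_inter_erase_eq, erase_union_erase_eq hab, hTr, hra, hrb] at hsub
    have hlow : v ≤ rkN M ((T.erase a).erase b) := by
      apply le_rkN_of_girth hg ((Finset.erase_subset _ _).trans ((Finset.erase_subset _ _).trans hTg))
      rw [Finset.card_erase_of_mem (Finset.mem_erase.2 ⟨hab.symm, hb⟩), Finset.card_erase_of_mem ha, hTc]
      omega
    omega
  have h12r := hpair y₁ y₂ h12 h₁.1 h₂.1 h₁.2 h₂.2
  have h13r := hpair y₁ y₃ h13 h₁.1 h₃.1 h₁.2 h₃.2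
  -- submodularity on `T ∖ {y₁, y₂}` and `T ∖ {y₁, y₃}`
  have hsub := ThinTriangle.rkN_inter_add_union_le (M := M) ((T.erase y₁).erase y₂) ((T.erase y₁).erase y₃)
  have hy₂ : y₂ ∈ T.erase y₁ := Finset.mem_erase.2 ⟨h12.symm, h₂.1⟩
  have hy₃ : y₃ ∈ T.erase y₁ := Finset.mem_erase.2 ⟨h13.symm, h₃.1⟩
  rw [erase_inter_erase_eq, erase_union_erase_eq h23, h12r, h13r, h₁.2] at hsub
  -- the triple erasure is a `v`-set, hence of rank `v`
  have hR : rkN M (((T.erase y₁).erase y₂).erase y₃) = v := by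
    apply rkN_eq_of_card_eq_of_girth hg
    · exact (Finset.erase_subset _ _).trans ((Finset.erase_subset _ _).trans ((Finset.erase_subset _ _).trans hTg))
    · rw [Finset.card_erase_of_mem (Finset.mem_erase.2 ⟨h23.symm, hy₃⟩), Finset.card_erase_of_mem hy₂,
        Finset.card_erase_of_mem h₁.1, hTc]
      omega
  omega

/-- The `(v+2)`-subsets of rank `v + 1` of a `(v+3)`-set `T` of rank `v + 2` number at most two. -/
theorem card_filter_rkN_le_two {v : ℕ} (hg : ∀ T ⊆ M.E, T.encard ≤ v → M.Indep T) {T : Finset α}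
    (hTg : T ⊆ gr M) (hTc : T.card = v + 3) (hTr : rkN M T = v + 2) :
    ((T.powersetCard (v + 2)).filter (fun S => rkN M S = v + 1)).card ≤ 2 := by
  have hsub : (T.powersetCard (v + 2)).filter (fun S => rkN M S = v + 1) ⊆
      (T.filter (fun y => rkN M (T.erase y) = v + 1)).image (fun y => T.erase y) := by
    intro S hS
    rw [Finset.mem_filter, Finset.mem_powersetCard] at hS
    obtain ⟨⟨hST, hSc⟩, hSr⟩ := hS
    have hc1 : (T \ S).card = 1 := by
      rw [Finset.card_sdiff_of_subset hST, hTc, hSc]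
      omega
    obtain ⟨y, hy⟩ := Finset.card_eq_one.1 hc1
    have hyT : y ∈ T := by
      have : y ∈ T \ S := by rw [hy]; exact Finset.mem_singleton_self y
      exact (Finset.mem_sdiff.1 this).1
    have hSy : S = T.erase y := by
      rw [← Finset.sdiff_singleton_eq_erase, ← hy, Finset.sdiff_sdiff_eq_self hST]
    rw [Finset.mem_image]
    exact ⟨y, Finset.mem_filter.2 ⟨hyT, hSy ▸ hSr⟩, hSy.symm⟩
  calc ((T.powersetCard (v + 2)).filter (fun S => rkN M S = v + 1)).card
      ≤ ((T.filter (fun y => rkN M (T.erase y) = v + 1)).image (fun y => T.erase y)).card :=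
        Finset.card_le_card hsub
    _ ≤ (T.filter (fun y => rkN M (T.erase y) = v + 1)).card := Finset.card_image_le
    _ ≤ 2 := card_filter_erase_le_two hg hTg hTc hTr

/-- **Two nullity-two subsets contradict submodularity.** A `(v+4)`-subset `T` of the ground set of rank `v + 2`, at
girth `≥ v + 1`, contains at most one `(v+2)`-subset of rank `v`. -/
theorem card_filter_rkN_le_one {v : ℕ} (hg : ∀ T ⊆ M.E, T.encard ≤ v → M.Indep T) {T : Finset α}
    (hTg : T ⊆ gr M) (hTc : T.card = v + 4) (hTr : rkN M T = v + 2) :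
    ((T.powersetCard (v + 2)).filter (fun S => rkN M S = v)).card ≤ 1 := by
  by_contra hcon
  have h2 : 1 < ((T.powersetCard (v + 2)).filter (fun S => rkN M S = v)).card := by omega
  obtain ⟨S, S', hS, hS', hne⟩ := Finset.one_lt_card_iff.1 h2
  rw [Finset.mem_filter, Finset.mem_powersetCard] at hS hS'
  obtain ⟨⟨hST, hSc⟩, hSr⟩ := hS
  obtain ⟨⟨hS'T, hS'c⟩, hS'r⟩ := hS'
  -- the union has at least `v + 3` points, the intersection at least `v`
  have hunion : v + 3 ≤ (S ∪ S').card := by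
    have hlt : S ⊂ S ∪ S' := by
      rw [Finset.ssubset_iff_subset_ne]
      refine ⟨Finset.subset_union_left, ?_⟩
      intro h
      apply hne
      have h1 : S' ⊆ S := by rw [h]; exact Finset.subset_union_right
      exact (Finset.eq_of_subset_of_card_le h1 (by omega)).symm
    have := Finset.card_lt_card hlt
    omega
  have hinter : v ≤ (S ∩ S').card := by
    have h := Finset.card_union_add_card_inter S S'
    have hle : (S ∪ S').card ≤ T.card := Finset.card_le_card (Finset.union_subset hST hS'T)
    omega
  have hIr : v ≤ rkN M (S ∩ S') :=
    le_rkN_of_girth hg (Finset.inter_subset_left.trans (hST.trans hTg)) hinter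
  -- submodularity: the union has rank `≤ v`
  have hsub := ThinTriangle.rkN_inter_add_union_le (M := M) S S'
  rw [hSr, hS'r] at hsub
  -- but the union sits inside `T` with at most one point missing
  have hU : rkN M T ≤ rkN M (S ∪ S') + (T \ (S ∪ S')).card :=
    rkN_le_rkN_add_card_sdiff (Finset.union_subset hST hS'T)
  have hmiss : (T \ (S ∪ S')).card ≤ 1 := by
    rw [Finset.card_sdiff_of_subset (Finset.union_subset hST hS'T)]
    omega
  omega

/-- **The double count for a family**: if every set of at most `v` points is independent and `ρ(E) ≥ v + 3`, then a
family `P` of `(v+2)`-subsets of the ground set is at most as large as any family `L` that contains the independent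
members of `P`, the sets `S ∪ {y}` (`y ∉ cl S`) for the members `S` of rank `v + 1`, and the sets `S ∪ {y, y'}`
(`y ∉ cl S`, `y' ∉ cl(S ∪ y)`) for the members of rank `v`. -/
theorem card_le_card_of_girth_pred_family {v : ℕ} (hg : ∀ T ⊆ M.E, T.encard ≤ v → M.Indep T)
    (hrank : ((v + 3 : ℕ) : ℕ∞) ≤ M.eRank) {P L : Finset (Finset α)}
    (hP : P ⊆ Finset.powersetCard (v + 2) (gr M))
    (hL1 : ∀ S ∈ P, M.Indep (S : Set α) → S ∈ L)
    (hL2 : ∀ S ∈ P, rkN M S = v + 1 → ∀ y ∈ gr M, y ∉ M.closure (S : Set α) → insert y S ∈ L)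
    (hL3 : ∀ S ∈ P, rkN M S = v → ∀ y ∈ gr M, y ∉ M.closure (S : Set α) →
      ∀ y' ∈ gr M, y' ∉ M.closure ((insert y S : Finset α) : Set α) → insert y' (insert y S) ∈ L) :
    P.card ≤ L.card := by
  classical
  have hPmem : ∀ S ∈ P, S ⊆ gr M ∧ S.card = v + 2 := fun S hS => Finset.mem_powersetCard.1 (hP hS)
  -- the three classes of members
  set I := P.filter (fun S : Finset α => M.Indep (S : Set α)) with hI
  set D₁ := P.filter (fun S : Finset α => rkN M S = v + 1) with hD₁
  set D₂ := P.filter (fun S : Finset α => rkN M S = v) with hD₂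
  -- the three classes of targets (subsets of the ground set of the right size and rank)
  set T₁ := L.filter (fun T : Finset α => T ⊆ gr M ∧ T.card = v + 3 ∧ rkN M T = v + 2) with hT₁
  set T₂ := L.filter (fun T : Finset α => T ⊆ gr M ∧ T.card = v + 4 ∧ rkN M T = v + 2) with hT₂
  -- a member is independent, or of rank `v + 1`, or of rank `v`
  have hclass : ∀ S ∈ P, M.Indep (S : Set α) ∨ rkN M S = v + 1 ∨ rkN M S = v := by
    intro S hS
    obtain ⟨hSg, hSc⟩ := hPmem S hS
    by_cases hi : M.Indep (S : Set α)
    · exact Or.inl hi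
    · right
      have hlt : rkN M S < S.card := ThinGirth.rkN_lt_card_of_not_indep hi
      have hge : v ≤ rkN M S := le_rkN_of_girth hg hSg (by omega)
      omega
  have hIrk : ∀ S ∈ I, rkN M S = v + 2 := by
    intro S hS
    rw [hI, Finset.mem_filter] at hS
    rw [Staged.rkN_eq_iff, hS.2.eRk_eq_encard, Set.encard_coe_eq_coe_finsetCard, (hPmem S hS.1).2]
  have hcover : P.card = I.card + D₁.card + D₂.card := by
    have hdisj1 : Disjoint I D₁ := by
      rw [Finset.disjoint_left]
      intro S hSI hSD
      have h1 := hIrk S hSI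
      rw [hD₁, Finset.mem_filter] at hSD
      omega
    have hdisj2 : Disjoint (I ∪ D₁) D₂ := by
      rw [Finset.disjoint_left]
      intro S hSU hSD
      rw [hD₂, Finset.mem_filter] at hSD
      rcases Finset.mem_union.1 hSU with hSI | hSD₁
      · have := hIrk S hSI; omega
      · rw [hD₁, Finset.mem_filter] at hSD₁; omega
    have hP' : P = I ∪ D₁ ∪ D₂ := by
      ext S
      constructor
      · intro hS
        rcases hclass S hS with h | h | h
        · exact Finset.mem_union.2 (Or.inl (Finset.mem_union.2 (Or.inl (Finset.mem_filter.2 ⟨hS, h⟩))))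
        · exact Finset.mem_union.2 (Or.inl (Finset.mem_union.2 (Or.inr (Finset.mem_filter.2 ⟨hS, h⟩))))
        · exact Finset.mem_union.2 (Or.inr (Finset.mem_filter.2 ⟨hS, h⟩))
      · intro hS
        rcases Finset.mem_union.1 hS with h | h
        · rcases Finset.mem_union.1 h with h' | h'
          · exact (Finset.mem_filter.1 h').1
          · exact (Finset.mem_filter.1 h').1
        · exact (Finset.mem_filter.1 h).1
    rw [hP', Finset.card_union_of_disjoint hdisj2, Finset.card_union_of_disjoint hdisj1]
  have hnotMem : ∀ S : Finset α, S ⊆ gr M → ∀ y, y ∉ M.closure (S : Set α) → y ∉ S := by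
    intro S hSg y hy h
    exact hy (M.subset_closure (S : Set α) (by rw [← coe_gr]; exact_mod_cast hSg) (Finset.mem_coe.2 h))
  -- the count of the rank-`(v+1)` members against `T₁`: two targets each, two sources each
  have hcount1 : D₁.card ≤ T₁.card := by
    have h := Finset.card_mul_le_card_mul (fun (S T : Finset α) => S ⊆ T) (s := D₁) (t := T₁) (m := 2) (n := 2) ?_ ?_
    · omega
    · intro S hS
      rw [hD₁, Finset.mem_filter] at hS
      obtain ⟨hSP, hSr⟩ := hS
      obtain ⟨hSg, hSc⟩ := hPmem S hSP
      have hout : 2 ≤ ((gr M).filter (fun x => x ∉ M.closure (S : Set α))).card :=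
        two_le_card_out hrank (by rw [← Staged.coe_rkN, hSr])
      have himg : ((gr M).filter (fun x => x ∉ M.closure (S : Set α))).image (fun y => insert y S) ⊆
          Finset.bipartiteAbove (fun (S T : Finset α) => S ⊆ T) T₁ S := by
        intro T hT
        rw [Finset.mem_image] at hT
        obtain ⟨y, hy, rfl⟩ := hT
        rw [Finset.mem_filter] at hy
        have hyS : y ∉ S := hnotMem S hSg y hy.2
        rw [Finset.mem_bipartiteAbove, hT₁, Finset.mem_filter]
        refine ⟨⟨hL2 S hSP hSr y hy.1 hy.2, Finset.insert_subset hy.1 hSg, ?_, ?_⟩, Finset.subset_insert y S⟩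
        · rw [Finset.card_insert_of_notMem hyS, hSc]
        · rw [rkN_insert_of_notMem_closure hy.1 hy.2, hSr]
      have hinj : Set.InjOn (fun y => insert y S) (((gr M).filter (fun x => x ∉ M.closure (S : Set α))) : Set α) := by
        intro y hy y' hy' hyy'
        rw [Finset.mem_coe, Finset.mem_filter] at hy hy'
        have hyS : y ∉ S := hnotMem S hSg y hy.2
        simp only at hyy'
        have : y ∈ insert y' S := hyy' ▸ Finset.mem_insert_self y S
        rcases Finset.mem_insert.1 this with h | h
        · exact h
        · exact absurd h hyS
      calc 2 ≤ ((gr M).filter (fun x => x ∉ M.closure (S : Set α))).card := hout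
        _ = (((gr M).filter (fun x => x ∉ M.closure (S : Set α))).image (fun y => insert y S)).card :=
            (Finset.card_image_of_injOn hinj).symm
        _ ≤ (Finset.bipartiteAbove (fun (S T : Finset α) => S ⊆ T) T₁ S).card := Finset.card_le_card himg
    · intro T hT
      rw [hT₁, Finset.mem_filter] at hT
      obtain ⟨_, hTg, hTc, hTr⟩ := hT
      have hsub : Finset.bipartiteBelow (fun (S T : Finset α) => S ⊆ T) D₁ T ⊆
          (T.powersetCard (v + 2)).filter (fun S => rkN M S = v + 1) := by
        intro S hS
        rw [Finset.mem_bipartiteBelow, hD₁, Finset.mem_filter] at hS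
        obtain ⟨⟨hSP, hSr⟩, hST⟩ := hS
        rw [Finset.mem_filter, Finset.mem_powersetCard]
        exact ⟨⟨hST, (hPmem S hSP).2⟩, hSr⟩
      exact (Finset.card_le_card hsub).trans (card_filter_rkN_le_two hg hTg hTc hTr)
  -- the count of the rank-`v` members against `T₂`: one target each, one source each
  have hcount2 : D₂.card ≤ T₂.card := by
    have h := Finset.card_mul_le_card_mul (fun (S T : Finset α) => S ⊆ T) (s := D₂) (t := T₂) (m := 1) (n := 1) ?_ ?_
    · omega
    · intro S hS
      rw [hD₂, Finset.mem_filter] at hS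
      obtain ⟨hSP, hSr⟩ := hS
      obtain ⟨hSg, hSc⟩ := hPmem S hSP
      obtain ⟨y, hyg, hyc⟩ := exists_notMem_closure_of_rkN_eq hSr (le_trans (by exact_mod_cast (by omega : v + 1 ≤ v + 3)) hrank)
      have hyS : y ∉ S := hnotMem S hSg y hyc
      have hSy : rkN M (insert y S) = v + 1 := by rw [rkN_insert_of_notMem_closure hyg hyc, hSr]
      obtain ⟨y', hy'g, hy'c⟩ := exists_notMem_closure_of_rkN_eq hSy (le_trans (by exact_mod_cast (by omega : v + 2 ≤ v + 3)) hrank)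
      have hy'S : y' ∉ insert y S := hnotMem (insert y S) (Finset.insert_subset hyg hSg) y' hy'c
      refine Finset.card_pos.2 ⟨insert y' (insert y S), ?_⟩
      rw [Finset.mem_bipartiteAbove, hT₂, Finset.mem_filter]
      refine ⟨⟨hL3 S hSP hSr y hyg hyc y' hy'g hy'c, Finset.insert_subset hy'g (Finset.insert_subset hyg hSg), ?_, ?_⟩,
        (Finset.subset_insert y S).trans (Finset.subset_insert y' _)⟩
      · rw [Finset.card_insert_of_notMem hy'S, Finset.card_insert_of_notMem hyS, hSc]
      · rw [rkN_insert_of_notMem_closure hy'g hy'c, hSy]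
    · intro T hT
      rw [hT₂, Finset.mem_filter] at hT
      obtain ⟨_, hTg, hTc, hTr⟩ := hT
      have hsub : Finset.bipartiteBelow (fun (S T : Finset α) => S ⊆ T) D₂ T ⊆
          (T.powersetCard (v + 2)).filter (fun S => rkN M S = v) := by
        intro S hS
        rw [Finset.mem_bipartiteBelow, hD₂, Finset.mem_filter] at hS
        obtain ⟨⟨hSP, hSr⟩, hST⟩ := hS
        rw [Finset.mem_filter, Finset.mem_powersetCard]
        exact ⟨⟨hST, (hPmem S hSP).2⟩, hSr⟩
      exact (Finset.card_le_card hsub).trans (card_filter_rkN_le_one hg hTg hTc hTr)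
  -- the three target classes are disjoint subsets of `L`
  have hI_sub : I ⊆ L := by
    intro S hS
    rw [hI, Finset.mem_filter] at hS
    exact hL1 S hS.1 hS.2
  have hT₁_sub : T₁ ⊆ L := Finset.filter_subset _ _
  have hT₂_sub : T₂ ⊆ L := Finset.filter_subset _ _
  have hd1 : Disjoint I T₁ := by
    rw [Finset.disjoint_left]
    intro S hSI hST
    rw [hT₁, Finset.mem_filter] at hST
    rw [hI, Finset.mem_filter] at hSI
    have := (hPmem S hSI.1).2
    omega
  have hd2 : Disjoint (I ∪ T₁) T₂ := by
    rw [Finset.disjoint_left]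
    intro S hSU hST
    rw [hT₂, Finset.mem_filter] at hST
    rcases Finset.mem_union.1 hSU with hSI | hST₁
    · rw [hI, Finset.mem_filter] at hSI
      have := (hPmem S hSI.1).2
      omega
    · rw [hT₁, Finset.mem_filter] at hST₁
      omega
  calc P.card = I.card + D₁.card + D₂.card := hcover
    _ ≤ I.card + T₁.card + T₂.card := by omega
    _ = (I ∪ T₁ ∪ T₂).card := by
        rw [Finset.card_union_of_disjoint hd2, Finset.card_union_of_disjoint hd1]
    _ ≤ L.card := Finset.card_le_card (Finset.union_subset (Finset.union_subset hI_sub hT₁_sub) hT₂_sub)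

end GirthRows

end PercRepro
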